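import Literature.Geometry.Riemannian.ConjugateHeatTestPairing
import Literature.Geometry.Riemannian.HeatKernelTimeRegularity
import Literature.Geometry.Riemannian.HeatKernelMeasurableData
import Literature.Geometry.Riemannian.LinearHeatVeryWeakClassical
import Literature.Geometry.Riemannian.TimeDerivativeContinuity
import Mathlib.MeasureTheory.Integral.Prod
import HarnessLib

/-!
# The heat kernel measures solve the conjugate heat equation very weakly in the evaluation time
# (Bamler 2020a, §2.3)

R. Bamler, *Entropy and heat kernel bounds on a Ricci flow background*, arXiv:2008.07093 (2020a),
§2.3: the conjugate heat kernel `K(x,t;·,·)` of a Ricci flow on a compact manifold solves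
`□* K = (−∂ₛ − Δ_{g_s} + R) K = 0` in the variables `(y, s)`, and `dν_{x,t;s} = K(x,t;·,s) dg_s`.
The tree has the measures `ν_{x,t;s}` (`heatKernelMeasure`, `HeatKernelMeasures.lean`) but not
yet `K`. This file proves the VERY WEAK form of that equation, which needs no density: for a
`C^∞` family `h` of Riemannian metrics on a closed manifold `M` (modelled on `ℝᵐ`) which is a
Ricci flow on `[a, t]`, every `x ∈ M` and every smooth test function `ζ` on `M × ℝ` compactly
supported in `M × (a, t)`,

  `∫_{(a,t)} ∫_M (∂ₛζ − Δ_{h(s)}ζ)(y, s) dν_{x,t;s}(y) ds = 0`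

(`IsRicciFlow.setIntegral_integral_testOp_heatKernelMeasure_eq_zero`). Read against the density
`K dg_s = K ρ dV_{g₀}` (`ρ` the density ratio, `∂ₛρ = −Rρ`) this is exactly the very weak conjugate
heat equation, the input of the hypoellipticity theorem
`exists_contMDiffOn_ae_eq_of_linearHeat_veryWeak` which produces the smooth kernel.

Proof: pair with an arbitrary smooth `ψ` through the conjugate heat solution `v` with `v(t) = ψ`
(`IsRicciFlow.integral_heatValueC_mul_eq`: `∫ (∫ φ dν_{x,t;s}) ψ(x) dV_t = ∫ φ v(s) dV_s`), so that
after Fubini the paired quantity is `∫ (d/ds ∫ ζ(s) v(s) dV_s) ds = 0`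
(`IsRicciFlow.integral_mul_sub_integral_mul_eq_intervalIntegral`, `ConjugateHeatTestPairing.lean`,
`ζ` vanishing near the ends of its time support); the fundamental lemma of the calculus of
variations on `M` (`eqOn_zero_of_forall_integral_mul_contMDiff_eq_zero`) and the continuity of the
space-time pairing in `x` conclude. Auxiliary results: `IsConjugateHeatSolutionOn.mono_Icc`,
uniform continuity in time of slices of continuous functions on `M × ℝ`
(`eventually_forall_abs_sub_lt_of_continuous`), continuity in `s` and joint measurability of
`(x, s) ↦ ∫ φ(s, ·) dν_{x,t;s}`.

Everything is proved; no definitions, no named facts.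

## References

* R. H. Bamler, *Entropy and heat kernel bounds on a Ricci flow background*, arXiv:2008.07093
  (2020), §2.3. [Bamler2020Entropy]
-/

noncomputable section

open Bundle Set Function Filter Manifold MeasureTheory Measure TopologicalSpace
open scoped Manifold ContDiff Topology ENNReal NNReal

namespace Literature.Geometry.Riemannian

open Lorentzian Lorentzian.PseudoRiemannianMetric

section VeryWeak

variable {m : ℕ} {H : Type*} [TopologicalSpace H]
  {I : ModelWithCorners ℝ (EuclideanSpace ℝ (Fin m)) H} [I.Boundaryless]
  {M : Type*} [TopologicalSpace M] [ChartedSpace H M] [IsManifold I ∞ M]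
  [T2Space M] [CompactSpace M] [SecondCountableTopology M] [MeasurableSpace M] [BorelSpace M]
  {h : ℝ → PseudoRiemannianMetric I ∞ (EuclideanSpace ℝ (Fin m)) (TangentSpace I : M → Type _)}
  {cov : ℝ → CovariantDerivative I (EuclideanSpace ℝ (Fin m)) (TangentSpace I : M → Type _)}

omit [T2Space M] [CompactSpace M] [SecondCountableTopology M] [MeasurableSpace M] [BorelSpace M]
  [I.Boundaryless] in
/-- Restriction of a conjugate heat solution to a closed subinterval with more than one point
(the one-sided time derivatives within the two intervals agree there). [folklore] -/
theorem IsConjugateHeatSolutionOn.mono_Icc {a b a' b' : ℝ} {v : ℝ → M → ℝ}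
    (hv : IsConjugateHeatSolutionOn h cov (Icc a b) v) (ha : a ≤ a') (hb : b' ≤ b) (hab' : a' < b') :
    IsConjugateHeatSolutionOn h cov (Icc a' b') v := by
  have hsub : Icc a' b' ⊆ Icc a b := Icc_subset_Icc ha hb
  refine ⟨hv.1.mono (prod_mono le_rfl hsub), fun r hr x ↦ ?_⟩
  have hd : HasDerivWithinAt (fun s ↦ v s x) (derivWithin (fun s ↦ v s x) (Icc a b) r) (Icc a b) r :=
    hasDerivWithinAt_time_of_contMDiffOn (by simp) hv.1 x (hsub hr)
  rw [(hd.mono hsub).derivWithin (uniqueDiffOn_Icc hab' r hr), hv.2 r (hsub hr) x]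

omit [T2Space M] [SecondCountableTopology M] [MeasurableSpace M] [BorelSpace M] [I.Boundaryless]
  [ChartedSpace H M] [IsManifold I ∞ M] in
/-- **Slices of a continuous function on `M × ℝ` vary uniformly continuously in the time
parameter** (`M` compact; tube lemma): `sup_y |Φ(y, r) − Φ(y, r₀)| → 0` as `r → r₀`. [folklore] -/
theorem eventually_forall_abs_sub_lt_of_continuous {Φ : M × ℝ → ℝ} (hΦ : Continuous Φ) (r₀ : ℝ)
    {ε : ℝ} (hε : 0 < ε) : ∀ᶠ r in 𝓝 r₀, ∀ y, |Φ (y, r) - Φ (y, r₀)| < ε := by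
  set n : Set (M × ℝ) := {p | |Φ p - Φ (p.1, r₀)| < ε}
  have hn : IsOpen n := isOpen_lt (by fun_prop) continuous_const
  have hp : (univ : Set M) ×ˢ ({r₀} : Set ℝ) ⊆ n := by
    rintro ⟨y, r⟩ ⟨-, hr⟩
    rw [mem_singleton_iff] at hr
    subst hr
    simpa [n] using hε
  obtain ⟨u, w, -, hw, hu, hr₀w, huw⟩ :=
    generalized_tube_lemma isCompact_univ isCompact_singleton hn hp
  filter_upwards [hw.mem_nhds (hr₀w (mem_singleton r₀))] with r hr y
  exact huw ⟨hu (mem_univ y), hr⟩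

variable (hh : IsContMDiffFamilyOn ∞ h univ) (hR : ∀ r, (h r).IsRiemannian)

/-- **Continuity in the evaluation time of space-time pairings with the heat kernel measures**:
for `Φ` continuous on `M × ℝ`, `s ↦ ∫ Φ(·, s) dν_{x,t;s}` is continuous on `ℝ` (weak continuity
of `s ↦ ν_{x,t;s}`, `continuous_integral_heatKernelMeasure_left`, and the uniform continuity of
the slices). [folklore] -/
theorem continuous_integral_slice_heatKernelMeasure {Φ : M × ℝ → ℝ} (hΦ : Continuous Φ)
    (t : ℝ) (x : M) : Continuous fun s ↦ ∫ y, Φ (y, s) ∂(heatKernelMeasure hh hR t x s) := by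
  refine continuous_iff_continuousAt.2 fun s₀ ↦ ?_
  rw [ContinuousAt, Metric.tendsto_nhds]
  intro ε hε
  have h2 := (continuous_integral_heatKernelMeasure_left hh hR t x (φ := fun y ↦ Φ (y, s₀))
    (hΦ.comp (Continuous.prodMk_left s₀))).tendsto s₀
  rw [Metric.tendsto_nhds] at h2
  filter_upwards [eventually_forall_abs_sub_lt_of_continuous hΦ s₀ (half_pos hε),
    h2 (ε / 2) (half_pos hε)] with s hs hs2
  have hi : ∀ r, Integrable (fun y ↦ Φ (y, r)) (heatKernelMeasure hh hR t x s) := fun r ↦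
    (hΦ.comp (Continuous.prodMk_left r)).integrable_of_hasCompactSupport
      (HasCompactSupport.of_compactSpace _)
  have h1 : |∫ y, Φ (y, s) ∂(heatKernelMeasure hh hR t x s) -
      ∫ y, Φ (y, s₀) ∂(heatKernelMeasure hh hR t x s)| ≤ ε / 2 := by
    rw [← integral_sub (hi s) (hi s₀)]
    have := norm_integral_le_of_norm_le_const (μ := heatKernelMeasure hh hR t x s)
      (f := fun y ↦ Φ (y, s) - Φ (y, s₀)) (C := ε / 2)
      (Eventually.of_forall fun y ↦ by rw [Real.norm_eq_abs]; exact (hs y).le)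
    simpa [Real.norm_eq_abs] using this
  rw [Real.dist_eq] at hs2 ⊢
  calc |∫ y, Φ (y, s) ∂(heatKernelMeasure hh hR t x s) -
        ∫ y, Φ (y, s₀) ∂(heatKernelMeasure hh hR t x s₀)|
      ≤ |∫ y, Φ (y, s) ∂(heatKernelMeasure hh hR t x s) -
          ∫ y, Φ (y, s₀) ∂(heatKernelMeasure hh hR t x s)| +
        |∫ y, Φ (y, s₀) ∂(heatKernelMeasure hh hR t x s) -
          ∫ y, Φ (y, s₀) ∂(heatKernelMeasure hh hR t x s₀)| := abs_sub_le _ _ _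
    _ < ε := by linarith

/-- **Joint measurability of `(x, s) ↦ ∫ Φ(·, s) dν_{x,t;s}`** for continuous `Φ` (continuous in
`s` for each `x`, continuous in `x` for each `s`). [folklore] -/
theorem measurable_uncurry_integral_slice_heatKernelMeasure {Φ : M × ℝ → ℝ} (hΦ : Continuous Φ)
    (t : ℝ) : Measurable (Function.uncurry fun (s : ℝ) (x : M) ↦
      ∫ y, Φ (y, s) ∂(heatKernelMeasure hh hR t x s)) :=
  measurable_uncurry_of_continuous_of_measurable
    (fun x ↦ continuous_integral_slice_heatKernelMeasure hh hR hΦ t x)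
    (fun s ↦ (continuous_integral_heatKernelMeasure hh hR
      (hΦ.comp (Continuous.prodMk_left s))).measurable)

/-- **The heat kernel measures solve the conjugate heat equation very weakly** (Bamler 2020a,
§2.3, `□*_{(y,s)} K(x,t;y,s) = 0`, integrated against `dν_{x,t;s} = K dg_s`): for a Ricci flow
`(h, cov)` of Riemannian metrics on `[a, t]` on a closed manifold, `x ∈ M`, and a smooth `ζ` on
`M × ℝ` with compact support inside `M × (a, t)`,

  `∫_{s ∈ (a,t)} ∫ (∂ₛζ(y, s) − Δ_{h(s)}ζ(·, s)(y)) dν_{x,t;s}(y) ds = 0`.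
[cite: Bamler2020Entropy, §2.3] -/
theorem IsRicciFlow.setIntegral_integral_testOp_heatKernelMeasure_eq_zero {a t : ℝ} (hat : a < t)
    (hflow : IsRicciFlow h cov (Icc a t)) (x : M) {ζ : M × ℝ → ℝ}
    (hζ : ContMDiff (I.prod 𝓘(ℝ, ℝ)) 𝓘(ℝ, ℝ) ∞ ζ) (hζc : HasCompactSupport ζ)
    (hζT : tsupport ζ ⊆ univ ×ˢ Ioo a t) :
    ∫ s in Ioo a t, ∫ y, (deriv (fun s' ↦ ζ (y, s')) s -
        (h s).laplaceBeltrami (fun y' ↦ ζ (y', s)) y) ∂(heatKernelMeasure hh hR t x s) = 0 := by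
  -- the test operator `φ s y = ∂ₛζ(y, s) − Δ_{h(s)}ζ(·, s)(y)`, continuous on `M × ℝ`
  set φ : ℝ → M → ℝ := fun s y ↦ deriv (fun s' ↦ ζ (y, s')) s -
    (h s).laplaceBeltrami (fun y' ↦ ζ (y', s)) y with hφ
  have hζ' : ContMDiffOn (I.prod 𝓘(ℝ, ℝ)) 𝓘(ℝ, ℝ) ∞ (fun p : M × ℝ ↦ (fun s y ↦ ζ (y, s)) p.2 p.1)
      (univ ×ˢ (univ : Set ℝ)) := by simpa using hζ.contMDiffOn
  have hφs : ContMDiff (I.prod 𝓘(ℝ, ℝ)) 𝓘(ℝ, ℝ) ∞ fun p : M × ℝ ↦ φ p.2 p.1 := by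
    have h1 := contMDiffOn_derivWithin_time_of_uniqueDiffOn (I := I) (u := fun s y ↦ ζ (y, s))
      uniqueDiffOn_univ hζ'
    have h2 := hh.contMDiffOn_laplaceBeltrami (f := fun s y ↦ ζ (y, s)) uniqueDiffOn_univ hζ'
    simp only [derivWithin_univ, univ_prod_univ, contMDiffOn_univ] at h1 h2
    exact h1.sub h2
  have hΦc : Continuous fun p : M × ℝ ↦ φ p.2 p.1 := hφs.continuous
  -- the time support: `φ s = 0` and `ζ(·, s) = 0` unless `s ∈ K = pr₂(tsupport ζ)`, `K ⊆ (a, t)`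
  set K : Set ℝ := Prod.snd '' tsupport ζ with hK
  have hKc : IsCompact K := hζc.image continuous_snd
  have hKsub : K ⊆ Ioo a t := by
    rintro s ⟨p, hp, rfl⟩
    exact (hζT hp).2
  have hzero : ∀ s ∉ K, ∀ y, ζ (y, s) = 0 ∧ φ s y = 0 := by
    intro s hs y
    have hys : (y, s) ∉ tsupport ζ := fun hy ↦ hs ⟨(y, s), hy, rfl⟩
    have hev : ζ =ᶠ[𝓝 (y, s)] 0 := notMem_tsupport_iff_eventuallyEq.1 hys
    refine ⟨hev.self_of_nhds, ?_⟩
    have hd : deriv (fun s' ↦ ζ (y, s')) s = 0 := by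
      have h1 : (fun s' ↦ ζ (y, s')) =ᶠ[𝓝 s] 0 :=
        eventuallyEq_zero_comp_of_eventuallyEq_zero (ι := fun s' ↦ (y, s'))
          (Continuous.prodMk_right y) hev
      rw [h1.deriv_eq]
      exact deriv_const s 0
    have hL : (h s).laplaceBeltrami (fun y' ↦ ζ (y', s)) y = 0 :=
      laplaceBeltrami_eq_zero_of_eventuallyEq_zero (h s)
        (eventuallyEq_zero_comp_of_eventuallyEq_zero (ι := fun y' ↦ (y', s))
          (Continuous.prodMk_left s) hev)
    simp [hφ, hd, hL]
  -- two times `a < s₁ < s₂ < t` with `K ⊆ (s₁, s₂)`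
  obtain ⟨s₁, s₂, has₁, hs₁₂, hs₂t, hKs⟩ : ∃ s₁ s₂, a < s₁ ∧ s₁ < s₂ ∧ s₂ < t ∧ K ⊆ Ioo s₁ s₂ := by
    rcases K.eq_empty_or_nonempty with hKe | hKne
    · refine ⟨a + (t - a) / 3, a + 2 * ((t - a) / 3), by linarith, by linarith, by linarith, ?_⟩
      simp [hKe]
    · have hmin := hKc.isLeast_sInf hKne
      have hmax := hKc.isGreatest_sSup hKne
      have h0 : a < sInf K := (hKsub hmin.1).1
      have h1 : sSup K < t := (hKsub hmax.1).2
      have h01 : sInf K ≤ sSup K := hmin.2 hmax.1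
      refine ⟨(a + sInf K) / 2, (sSup K + t) / 2, by linarith, by linarith, by linarith,
        fun s hs ↦ ⟨?_, ?_⟩⟩
      · linarith [hmin.2 hs]
      · linarith [hmax.2 hs]
  -- the pairing `F s x = ∫ φ(s) dν_{x,t;s}`, bounded, jointly measurable, continuous in `x`
  set F : ℝ → M → ℝ := fun s x' ↦ ∫ y, φ s y ∂(heatKernelMeasure hh hR t x' s) with hF
  obtain ⟨C, hC⟩ : ∃ C, ∀ s y, |φ s y| ≤ C := by
    obtain ⟨C, hC⟩ := (isCompact_univ.prod (isCompact_Icc (a := s₁) (b := s₂))).exists_bound_of_continuousOn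
      (f := fun p : M × ℝ ↦ φ p.2 p.1) hΦc.continuousOn
    refine ⟨max C 0, fun s y ↦ ?_⟩
    by_cases hs : s ∈ Icc s₁ s₂
    · exact ((Real.norm_eq_abs _).symm.le.trans (hC (y, s) ⟨mem_univ _, hs⟩)).trans (le_max_left _ _)
    · have : s ∉ K := fun hsK ↦ hs (Ioo_subset_Icc_self (hKs hsK))
      rw [(hzero s this y).2, abs_zero]
      exact le_max_right _ _
  have hFb : ∀ s x', |F s x'| ≤ C := fun s x' ↦
    abs_integral_heatKernelMeasure_le hh hR t x' s (fun y ↦ hC s y)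
  have hFz : ∀ s ∉ K, ∀ x', F s x' = 0 := fun s hs x' ↦ by
    simp [hF, fun y ↦ (hzero s hs y).2]
  have hFm : Measurable (Function.uncurry F) :=
    measurable_uncurry_integral_slice_heatKernelMeasure hh hR (Φ := fun p ↦ φ p.2 p.1) hΦc t
  have hFc : ∀ s, Continuous (F s) := fun s ↦
    continuous_integral_heatKernelMeasure hh hR (hΦc.comp (Continuous.prodMk_left s))
  -- reduce the time integral to `(s₁, s₂]`
  have hIoc : Ioc s₁ s₂ ⊆ Ioo a t := fun s hs ↦ ⟨has₁.trans hs.1, hs.2.trans_lt hs₂t⟩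
  have hred : ∀ x', ∫ s in Ioo a t, F s x' = ∫ s in Ioc s₁ s₂, F s x' := by
    intro x'
    refine setIntegral_eq_of_subset_of_forall_sdiff_eq_zero measurableSet_Ioo hIoc fun s hs ↦ ?_
    refine hFz s (fun hsK ↦ hs.2 ?_) x'
    exact ⟨(hKs hsK).1, (hKs hsK).2.le⟩
  show ∫ s in Ioo a t, F s x = 0
  rw [hred]
  -- `Φ x' = ∫_{(s₁,s₂]} F s x'` is continuous and pairs to zero with every smooth `ψ`
  set μ : Measure M := (h t).riemVolume with hμ
  haveI : IsFiniteMeasure μ := ⟨(h t).riemVolume_univ_lt_top⟩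
  haveI : μ.IsOpenPosMeasure := by
    rw [hμ, riemVolume_eq (hR t)]; exact isOpenPosMeasure_riemannianMeasure _
  have hΦcont : Continuous fun x' ↦ ∫ s in Ioc s₁ s₂, F s x' := by
    refine continuous_of_dominated (F := fun x' s ↦ F s x') (bound := fun _ ↦ C)
      (fun x' ↦ ?_) (fun x' ↦ ?_) (integrable_const C) (Eventually.of_forall fun s ↦ hFc s)
    · exact (hFm.comp (measurable_id.prodMk measurable_const)).aestronglyMeasurable
    · exact Eventually.of_forall fun s ↦ by rw [Real.norm_eq_abs]; exact hFb s x'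
  have key : ∀ ψ : M → ℝ, ContMDiff I 𝓘(ℝ, ℝ) ∞ ψ →
      ∫ x', (∫ s in Ioc s₁ s₂, F s x') * ψ x' ∂μ = 0 := by
    intro ψ hψ
    -- the conjugate heat solution `v` on `[s₁, t]` with `v(t) = ψ`
    have hflow₁ : IsRicciFlow h cov (Icc s₁ t) := hflow.mono (Icc_subset_Icc has₁.le le_rfl)
    obtain ⟨v, hvt, hv, -⟩ := hflow₁.exists_isConjugateHeatSolutionOn_Icc' (hs₁₂.trans hs₂t)
      (fun r _ ↦ hR r) hψ
    obtain ⟨B, hB⟩ : ∃ B, ∀ x', |ψ x'| ≤ B := by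
      obtain ⟨B, hB⟩ := isCompact_univ.exists_bound_of_continuousOn hψ.continuous.continuousOn
      exact ⟨B, fun x' ↦ (Real.norm_eq_abs _).symm.le.trans (hB x' (mem_univ _))⟩
    -- Fubini
    have hint : Integrable (Function.uncurry fun (x' : M) (s : ℝ) ↦ F s x' * ψ x')
        (μ.prod (volume.restrict (Ioc s₁ s₂))) := by
      refine Integrable.of_bound ?_ (C * |B|) ?_ -- bounded on a finite measure space
      · exact ((hFm.comp measurable_swap).mul
          (hψ.continuous.measurable.comp measurable_fst)).aestronglyMeasurable
      · refine Eventually.of_forall fun p ↦ ?_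
        obtain ⟨x', s⟩ := p
        rw [Function.uncurry_apply_pair, Real.norm_eq_abs, abs_mul]
        exact mul_le_mul (hFb _ _) ((hB x').trans (le_abs_self B)) (abs_nonneg _)
          ((abs_nonneg _).trans (hFb s x'))
    have hswap := integral_integral_swap hint
    simp only [integral_mul_const] at hswap
    rw [hswap]
    -- pairing at each `s ∈ (s₁, s₂]` and the total time derivative
    have hpair : ∀ s ∈ Ioc s₁ s₂, ∫ x', F s x' * ψ x' ∂μ =
        ∫ y, φ s y * v s y ∂(h s).riemVolume := by
      intro s hs
      have hst : s < t := hs.2.trans_lt hs₂t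
      have hvs : IsConjugateHeatSolutionOn h cov (Icc s t) v := hv.mono_Icc hs.1.le le_rfl hst
      have hφc : Continuous (φ s) := hΦc.comp (Continuous.prodMk_left s)
      have e : (fun x' ↦ F s x' * ψ x') = fun x' ↦ heatValueC h s t x' (φ s) * v t x' := by
        funext x'
        simp only [hF, integral_heatKernelMeasure hh hR hst x' hφc, hvt]
      rw [e]
      exact (hflow.mono (Icc_subset_Icc (has₁.trans hs.1).le le_rfl)).integral_heatValueC_mul_eq
        hh hR hst hφc hvs
    rw [setIntegral_congr_fun measurableSet_Ioc hpair, ← intervalIntegral.integral_of_le hs₁₂.le]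
    -- `∫_{s₁}^{s₂} ∫ φ(s) v(s) dV_s ds = [∫ ζ(s) v(s) dV_s]_{s₁}^{s₂} = 0 − 0`
    have hflow₁₂ : IsRicciFlow h cov (Icc s₁ s₂) := hflow.mono (Icc_subset_Icc has₁.le hs₂t.le)
    have hv₁₂ : IsConjugateHeatSolutionOn h cov (Icc s₁ s₂) v := hv.mono_Icc le_rfl hs₂t.le hs₁₂
    have hζ₁₂ : ContMDiffOn (I.prod 𝓘(ℝ, ℝ)) 𝓘(ℝ, ℝ) ∞
        (fun p : M × ℝ ↦ (fun s y ↦ ζ (y, s)) p.2 p.1) (univ ×ˢ Icc s₁ s₂) :=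
      hζ'.mono (prod_mono le_rfl (subset_univ _))
    have hD := hflow₁₂.integral_mul_sub_integral_mul_eq_intervalIntegral hs₁₂ (fun r _ ↦ hR r)
      (ζ := fun s y ↦ ζ (y, s)) hζ₁₂ hv₁₂
    have hs₁K : s₁ ∉ K := fun h1 ↦ lt_irrefl _ (hKs h1).1
    have hs₂K : s₂ ∉ K := fun h2 ↦ lt_irrefl _ (hKs h2).2
    have hz₁ : ∀ y, ζ (y, s₁) = 0 := fun y ↦ (hzero s₁ hs₁K y).1
    have hz₂ : ∀ y, ζ (y, s₂) = 0 := fun y ↦ (hzero s₂ hs₂K y).1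
    simp only [hz₁, hz₂, zero_mul, integral_zero, sub_zero] at hD
    have hcongr : ∫ s in s₁..s₂, ∫ y, φ s y * v s y ∂(h s).riemVolume =
        ∫ r in s₁..s₂, ∫ y, (derivWithin (fun r' ↦ ζ (y, r')) (Icc s₁ s₂) r -
          (h r).laplaceBeltrami (fun y' ↦ ζ (y', r)) y) * v r y ∂(h r).riemVolume := by
      refine intervalIntegral.integral_congr fun s hs ↦ ?_
      rw [uIcc_of_le hs₁₂.le] at hs
      refine integral_congr_ae (Eventually.of_forall fun y ↦ ?_)
      have hcurve : ContMDiff 𝓘(ℝ, ℝ) 𝓘(ℝ, ℝ) ∞ (fun s' ↦ ζ (y, s')) :=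
        hζ.comp (contMDiff_const.prodMk contMDiff_id)
      have hdiff : DifferentiableAt ℝ (fun s' ↦ ζ (y, s')) s :=
        (hcurve.contDiff.differentiable (by simp)).differentiableAt
      show φ s y * v s y = _
      simp only [hφ]
      rw [hdiff.derivWithin (uniqueDiffOn_Icc hs₁₂ s hs)]
    rw [hcongr]
    exact hD.symm
  -- fundamental lemma
  have hzero' := eqOn_zero_of_forall_integral_mul_contMDiff_eq_zero (J := I) μ isOpen_univ
    hΦcont.continuousOn (fun ψ hψ _ _ _ ↦ key ψ hψ)
  exact hzero' x (mem_univ x)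

end VeryWeak

end Literature.Geometry.Riemannian
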